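import Mathlib

/-!
# Eigenline decoupling: the exact block-triangular form behind the resonance factor (solo-blind kernel #171)

Finite-dimensional skeleton of paper 24.101(b) (PLAN §102): write the monodromy (or generator) of the
chain in the splitting `w ⊕ r` as `M = [[A, B], [C, D]]`.  If the columns `[V; 1]` span an
`M`-invariant subspace — `A V + B = V μ`, `C V + D = μ` (for the chain: `V(0)` = the slaving /
periodic-Riccati datum, `μ` = the top multiplier block) — then the shear `S = [[1, V], [0, 1]]`
conjugates `M` EXACTLY into block-lower-triangular form `S⁻¹ M S = [[A - V C, 0], [C, μ]]`
(the decoupled complement `D_K = A - V C` and the slow block `μ`), and the resolvent of a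
block-lower-triangular matrix is explicit:
`[[E, 0], [C, F]]⁻¹ = [[E⁻¹, 0], [-F⁻¹ C E⁻¹, F⁻¹]]`, whence
`‖(1 - M)⁻¹‖ ≤ ‖S‖ ‖S⁻¹‖ (a + f + f ‖C‖ a)` with `a = ‖(1 - D_K)⁻¹‖`, `f = ‖(1 - μ)⁻¹‖` —
the `K_res = O(P)` form of the resonance factor (the norm inequality itself is not formalised here;
this file is the exact algebra it rests on).
-/

namespace Summit.AnomalousDissipation.AnomalousDissipation.Theorems

open Matrix

section

variable {𝕜 m n : Type*} [CommRing 𝕜] [Fintype m] [Fintype n] [DecidableEq m] [DecidableEq n]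

/-- The shear `[[1, V], [0, 1]]` has two-sided inverse `[[1, -V], [0, 1]]` (right). -/
theorem soloBlind_shear_mul_negShear (V : Matrix m n 𝕜) :
    fromBlocks (1 : Matrix m m 𝕜) V 0 (1 : Matrix n n 𝕜) * fromBlocks 1 (-V) 0 1 = 1 := by
  rw [fromBlocks_multiply, ← fromBlocks_one]
  congr 1 <;> simp

/-- The shear `[[1, V], [0, 1]]` has two-sided inverse `[[1, -V], [0, 1]]` (left). -/
theorem soloBlind_negShear_mul_shear (V : Matrix m n 𝕜) :
    fromBlocks (1 : Matrix m m 𝕜) (-V) 0 (1 : Matrix n n 𝕜) * fromBlocks 1 V 0 1 = 1 := by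
  rw [fromBlocks_multiply, ← fromBlocks_one]
  congr 1 <;> simp

/-- **Eigenline decoupling.** If `[V; 1]` spans an invariant subspace of `[[A, B], [C, D]]`
(`A V + B = V μ`, `C V + D = μ`), the shear conjugation is exactly block-lower-triangular with
diagonal blocks `A - V C` (the decoupled complement) and `μ`. -/
theorem soloBlind_eigenline_decoupling (A : Matrix m m 𝕜) (B : Matrix m n 𝕜) (C : Matrix n m 𝕜)
    (D : Matrix n n 𝕜) (V : Matrix m n 𝕜) (μ : Matrix n n 𝕜)
    (h₁ : A * V + B = V * μ) (h₂ : C * V + D = μ) :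
    fromBlocks (1 : Matrix m m 𝕜) (-V) 0 (1 : Matrix n n 𝕜) * fromBlocks A B C D * fromBlocks 1 V 0 1
      = fromBlocks (A - V * C) 0 C μ := by
  have hTR : A * V + -(V * (C * V)) + (B + -(V * D)) = 0 := by
    have e : A * V + -(V * (C * V)) + (B + -(V * D)) = (A * V + B) - (V * (C * V) + V * D) := by
      abel
    rw [e, ← Matrix.mul_add, h₂, h₁, sub_self]
  rw [fromBlocks_multiply, fromBlocks_multiply]
  simp only [Matrix.one_mul, Matrix.mul_one, Matrix.zero_mul, Matrix.mul_zero, add_zero, zero_add,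
    Matrix.neg_mul]
  rw [fromBlocks_inj]
  refine ⟨(sub_eq_add_neg A (V * C)).symm, ?_, rfl, h₂⟩
  rw [Matrix.add_mul, Matrix.neg_mul, Matrix.mul_assoc]
  exact hTR

/-- In the decoupled coordinates the `w̃`-block of ANY matrix `X` is the rank-`n` correction
`X_ww - V X_rw` of its `w`-block (the formula the B10 certificate evaluates on enclosures). -/
theorem soloBlind_shear_conj_toBlocks₁₁ (X : Matrix (m ⊕ n) (m ⊕ n) 𝕜) (V : Matrix m n 𝕜) :
    (fromBlocks (1 : Matrix m m 𝕜) (-V) 0 (1 : Matrix n n 𝕜) * X * fromBlocks 1 V 0 1).toBlocks₁₁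
      = X.toBlocks₁₁ - V * X.toBlocks₂₁ := by
  conv_lhs => rw [← fromBlocks_toBlocks X]
  rw [fromBlocks_multiply, fromBlocks_multiply, toBlocks_fromBlocks₁₁]
  simp only [Matrix.one_mul, Matrix.mul_one, Matrix.mul_zero, add_zero, Matrix.neg_mul]
  exact (sub_eq_add_neg _ _).symm

/-- **Resolvent of a block-lower-triangular matrix.** If `E E' = 1 = E' E` and `F F' = 1 = F' F`
then `[[E, 0], [C, F]] · [[E', 0], [-(F' C E'), F']] = 1`. -/
theorem soloBlind_lowerTriangular_mul_inv (E E' : Matrix m m 𝕜) (F F' : Matrix n n 𝕜)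
    (C : Matrix n m 𝕜) (hE : E * E' = 1) (hF : F * F' = 1) :
    fromBlocks E 0 C F * fromBlocks E' 0 (-(F' * C * E')) F' = 1 := by
  rw [fromBlocks_multiply, ← fromBlocks_one]
  have hBL : C * E' + F * -(F' * C * E') = 0 := by
    rw [Matrix.mul_neg, ← Matrix.mul_assoc, ← Matrix.mul_assoc, hF, Matrix.one_mul, add_neg_cancel]
  rw [fromBlocks_inj]
  refine ⟨?_, ?_, hBL, ?_⟩
  · rw [Matrix.zero_mul, add_zero, hE]
  · rw [Matrix.mul_zero, Matrix.zero_mul, add_zero]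
  · rw [Matrix.mul_zero, zero_add, hF]

/-- The same inverse works on the left. -/
theorem soloBlind_inv_mul_lowerTriangular (E E' : Matrix m m 𝕜) (F F' : Matrix n n 𝕜)
    (C : Matrix n m 𝕜) (hE : E' * E = 1) (hF : F' * F = 1) :
    fromBlocks E' 0 (-(F' * C * E')) F' * fromBlocks E 0 C F = 1 := by
  rw [fromBlocks_multiply, ← fromBlocks_one]
  have hBL : -(F' * C * E') * E + F' * C = 0 := by
    rw [Matrix.neg_mul, Matrix.mul_assoc, hE, Matrix.mul_one, neg_add_cancel]
  rw [fromBlocks_inj]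
  refine ⟨?_, ?_, hBL, ?_⟩
  · rw [Matrix.zero_mul, add_zero, hE]
  · rw [Matrix.mul_zero, Matrix.zero_mul, add_zero]
  · rw [Matrix.mul_zero, zero_add, hF]

omit [Fintype m] [Fintype n] in
/-- `1 - [[A, B], [C, D]] = [[1 - A, -B], [-C, 1 - D]]`. -/
theorem soloBlind_one_sub_fromBlocks (A : Matrix m m 𝕜) (B : Matrix m n 𝕜) (C : Matrix n m 𝕜)
    (D : Matrix n n 𝕜) :
    1 - fromBlocks A B C D = fromBlocks (1 - A) (-B) (-C) (1 - D) := by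
  rw [← fromBlocks_one, sub_eq_add_neg, fromBlocks_neg, fromBlocks_add]
  simp [sub_eq_add_neg]

/-- **The resonance factor in decoupled form.** Under the eigenline hypotheses, if `1 - (A - V C)`
and `1 - μ` have two-sided inverses `a`, `f`, then `1 - M` has the explicit two-sided inverse
`S · [[a, 0], [f C a, f]] · S⁻¹` with the shear `S = [[1, V], [0, 1]]`. -/
theorem soloBlind_resolvent_of_eigenline (A : Matrix m m 𝕜) (B : Matrix m n 𝕜) (C : Matrix n m 𝕜)
    (D : Matrix n n 𝕜) (V : Matrix m n 𝕜) (μ : Matrix n n 𝕜)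
    (h₁ : A * V + B = V * μ) (h₂ : C * V + D = μ)
    (a : Matrix m m 𝕜) (f : Matrix n n 𝕜)
    (ha : (1 - (A - V * C)) * a = 1) (ha' : a * (1 - (A - V * C)) = 1)
    (hf : (1 - μ) * f = 1) (hf' : f * (1 - μ) = 1) :
    let S : Matrix (m ⊕ n) (m ⊕ n) 𝕜 := fromBlocks 1 V 0 1
    let S' : Matrix (m ⊕ n) (m ⊕ n) 𝕜 := fromBlocks 1 (-V) 0 1
    let R : Matrix (m ⊕ n) (m ⊕ n) 𝕜 := fromBlocks a 0 (f * C * a) f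
    (1 - fromBlocks A B C D) * (S * R * S') = 1 ∧ (S * R * S') * (1 - fromBlocks A B C D) = 1 := by
  intro S S' R
  have hSS' : S * S' = 1 := soloBlind_shear_mul_negShear V
  have hS'S : S' * S = 1 := soloBlind_negShear_mul_shear V
  -- the conjugated `1 - M`
  have hconj : S' * (1 - fromBlocks A B C D) * S = fromBlocks (1 - (A - V * C)) 0 (-C) (1 - μ) := by
    rw [Matrix.mul_sub, Matrix.sub_mul, Matrix.mul_one, hS'S,
      soloBlind_eigenline_decoupling A B C D V μ h₁ h₂, soloBlind_one_sub_fromBlocks]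
    simp
  have hR : fromBlocks (1 - (A - V * C)) 0 (-C) (1 - μ) * R = 1 := by
    have := soloBlind_lowerTriangular_mul_inv (1 - (A - V * C)) a (1 - μ) f (-C) ha hf
    simpa [R, Matrix.mul_neg, Matrix.neg_mul] using this
  have hR' : R * fromBlocks (1 - (A - V * C)) 0 (-C) (1 - μ) = 1 := by
    have := soloBlind_inv_mul_lowerTriangular (1 - (A - V * C)) a (1 - μ) f (-C) ha' hf'
    simpa [R, Matrix.mul_neg, Matrix.neg_mul] using this
  -- undo the conjugation: 1 - M = S (S'(1-M)S) S'
  have hM : 1 - fromBlocks A B C D = S * (fromBlocks (1 - (A - V * C)) 0 (-C) (1 - μ)) * S' := by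
    rw [← hconj]
    simp only [← Matrix.mul_assoc, hSS', Matrix.one_mul]
    rw [Matrix.mul_assoc, hSS', Matrix.mul_one]
  constructor
  · rw [hM]
    calc S * fromBlocks (1 - (A - V * C)) 0 (-C) (1 - μ) * S' * (S * R * S')
        = S * (fromBlocks (1 - (A - V * C)) 0 (-C) (1 - μ) * ((S' * S) * R)) * S' := by
          simp only [Matrix.mul_assoc]
      _ = 1 := by rw [hS'S, Matrix.one_mul, hR, Matrix.mul_one, hSS']
  · rw [hM]
    calc S * R * S' * (S * fromBlocks (1 - (A - V * C)) 0 (-C) (1 - μ) * S')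
        = S * (R * ((S' * S) * fromBlocks (1 - (A - V * C)) 0 (-C) (1 - μ))) * S' := by
          simp only [Matrix.mul_assoc]
      _ = 1 := by rw [hS'S, Matrix.one_mul, hR', Matrix.mul_one, hSS']

end

end Summit.AnomalousDissipation.AnomalousDissipation.Theorems
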